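import Literature.AlgebraicGeometry.RelativeSpec.StableAffineOpenProjectiveOverAffine
import Literature.AlgebraicGeometry.Morphisms.ProjectiveSpaceOverAffine
import Literature.AlgebraicGeometry.Morphisms.ProjectiveMorphism
import HarnessLib

/-!
# Stable affine opens for a finite group action on a scheme PROJECTIVE (Hartshorne's sense) over an affine base
# (SGA 1 V 1.8 — proofs only; the `Morphisms.IsProjective` currency)

Topic `Literature/AlgebraicGeometry/RelativeSpec`; namespace `Literature.AlgebraicGeometry.RelativeSpec`. THEOREMS ONLY. Cell
`hodgecm-mathlib`, P6 «MOD programme», LEAD F0P6-plan M-1b HAND M-A ∕ P6a ED.-2 census (8396c07d) row `_hcovθ`: «★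
`forall_exists_stableAffineOpen_over` (B-p18) on a projective localisation (★ A-p03 PROJ-SPREAD)».  The two ★ pieces speak different
currencies — ★ `StableAffineOpenProjectiveOverAffine` wants a closed immersion into `Proj` of a graded ring, while ★
`Limits/LocalizationProjectiveSpread` ∕ `IntegralModelOfGlobalModel.isProjective_localise_total_hom` deliver ★ `Morphisms.IsProjective`
(a closed immersion into `𝐏(ι; Spec A) = Spec A ×_ℤ ℙ^{#ι}_ℤ` followed by the projection).  This file is the bridge: over an affine base
`Spec A`, `𝐏(ι; Spec A) ≅ Proj A[x₀, …, x_{#ι}]` (★ `Morphisms.isPullback_projToSpec_projMap_terminal`), so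

* `forall_exists_stableAffineOpen_of_isProjective` — for `f : X ⟶ Spec A` with `Morphisms.IsProjective f` and a finite group `G`
  acting on `X` over `Spec A`, every point of `X` lies in a `G`-stable open affine over `Spec A`;
* `forall_exists_stableAffineOpen_over_of_isProjective` — the `Over (Spec A)` spelling (= the `_hcovθ` ∕ `_hcov` letters verbatim);
* `finiteSubsetsInAffineOpens_of_isProjective` — finite subsets lie in opens affine over `Spec A`.

## References
* [SGA1] A. Grothendieck, SGA 1, Exp. V, Prop. 1.8.
* [Hartshorne1977] R. Hartshorne, *Algebraic Geometry*, II §4 Definition p. 103 (projective morphism).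
-/

noncomputable section

universe u

open CategoryTheory Limits AlgebraicGeometry

namespace Literature.AlgebraicGeometry.RelativeSpec

open Literature.AlgebraicGeometry.Morphisms

variable {A : Type u} [CommRing A] {X : Scheme.{u}}

/-- **Every point of a scheme projective (Hartshorne) over `Spec A` with a finite group action over `Spec A` lies in a `G`-stable open,
affine over `Spec A`** — ★ `forall_exists_stableAffineOpen_of_isClosedImmersion_proj` after transporting the closed immersion
`X ↪ 𝐏(ι; Spec A)` to `X ↪ Proj A[x₀,…,x_{#ι}]` along ★ `isPullback_projToSpec_projMap_terminal`. [cite: SGA1, Exp. V, Prop. 1.8]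
[cite: Hartshorne1977, II §4 Definition p.103 (projective morphism)] -/
theorem forall_exists_stableAffineOpen_of_isProjective (f : X ⟶ Spec (.of A)) (hf : IsProjective f)
    {G : Type*} [Group G] [Finite G] (ρ : ActionOver f G) (x : X) :
    ∃ O : ρ.StableAffineOpens, x ∈ O.1 := by
  obtain ⟨ι, hι, j, hj, -⟩ := hf
  letI := MvPolynomial.gradedAlgebra (σ := Fin (Nat.card ι + 1)) (R := A)
  letI : Algebra intU.{u} A := ULift.algebra' ℤ A
  let e := (isPullback_projToSpec_projMap_terminal ι A).isoPullback
  haveI : IsClosedImmersion (j ≫ e.inv) := inferInstance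
  exact forall_exists_stableAffineOpen_of_isClosedImmersion_proj
    (MvPolynomial.homogeneousSubmodule (Fin (Nat.card ι + 1)) A) (j ≫ e.inv) ρ x

/-- **The `Over (Spec A)` spelling** (= the letters `_hcovθ` ∕ `_hcov` of the P6 moduli core verbatim): for `X : Over (Spec A)` with
`IsProjective X.hom` and `ρ : ActionOver X.hom G`, `∀ x : X.left, ∃ O : ρ.StableAffineOpens, x ∈ O.1`. [cite: SGA1, Exp. V, Prop. 1.8] -/
theorem forall_exists_stableAffineOpen_over_of_isProjective (X : Over (Spec (CommRingCat.of A))) (hX : IsProjective X.hom)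
    {G : Type*} [Group G] [Finite G] (ρ : ActionOver X.hom G) :
    ∀ x : X.left, ∃ O : ρ.StableAffineOpens, x ∈ O.1 :=
  forall_exists_stableAffineOpen_of_isProjective X.hom hX ρ

/-- **Finite subsets of a scheme projective over `Spec A` lie in opens affine over `Spec A`** (tree currency `FiniteSubsetsInAffineOpens`).
[cite: SGA1, Exp. V, Prop. 1.8] -/
theorem finiteSubsetsInAffineOpens_of_isProjective (f : X ⟶ Spec (.of A)) (hf : IsProjective f) :
    FiniteSubsetsInAffineOpens f := by
  obtain ⟨ι, hι, j, hj, -⟩ := hf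
  letI := MvPolynomial.gradedAlgebra (σ := Fin (Nat.card ι + 1)) (R := A)
  letI : Algebra intU.{u} A := ULift.algebra' ℤ A
  let e := (isPullback_projToSpec_projMap_terminal ι A).isoPullback
  haveI : IsClosedImmersion (j ≫ e.inv) := inferInstance
  exact finiteSubsetsInAffineOpens_of_isClosedImmersion_proj f (MvPolynomial.homogeneousSubmodule (Fin (Nat.card ι + 1)) A)
    (j ≫ e.inv)

end Literature.AlgebraicGeometry.RelativeSpec
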